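import Summits.QuantumFields.YangMills.Theorems.AllWindowsColdBoxBoxHighLineStep2Wick

/-!
# T-S5 STEP 2 — the EXPONENTIAL TILT on the small-field set and the last assembly bricks (task statements, planner ym-idea-2 g18)

Companion of `Cruxes/BoxHighWindowsSU22/ASSEMBLY-S5.md` (§5 Gaussian normal form, §6 second-order interpolation): the letters the assembler of
`stub_landauSecondOrder` (T-S5.13) interpolates in, and four task Props provable now, by name, `--supports stmt-QuantumFields-24004`:

* `ghostLogRatio`, `haarLogRatio`, **`tiltU β H a`** = the full non-Gaussian exponent of the FP-chart weight on the small-field set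
  (`= −cubicVertex − quarticWilson − β(Φ − divLinSq) + ghostLogRatio + haarLogRatio`, ASSEMBLY-S5 §5), and the abstract exponential-tilt
  expectations `Tilt.tiltExp μ U t G = ∫ G e^{tU} dμ / ∫ e^{tU} dμ` with their covariance / third / fourth joint cumulants;
* **T-S5.5n `FPChartWeightOnSmallField`** (S): on `smallField H s` (`s ≤ r`, `s < π`, `det F_FP(U(a)) ≠ 0`) the FP-chart weight FACTORISES EXACTLY as
  `|det F₁| · σ(0)^n · e^{−β·boxQuadForm} · e^{tiltU}` (uses ✓/⧗T-S5.7e `QuadFormSplit`, `boxWilson = Σ_{p touching} chartPlaqCost` which is `rfl`-level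
  from `wilsonBoundaryAction`/`plaqCostAt`, `ballCutoff = 1` from `linkDefect (expPauli v) ≤ ‖v‖² ≤ s² ≤ r²`, `sigmaSU2_pos`);
* **T-S5.6s `SmallFieldSmallPlaquettes`** (S): `smallField H s ⊆ edgeChart⁻¹ {SmallPlaquettes H spl}` once `17 s² ≤ spl²`, `s ≤ 1/100`
  (✓w2 `PlaqCost.abs_plaquetteCost_sub_dot_le`: cost ≤ 16s² + 32s³ + 44s⁴; links off the box carry `a = 0`);
* **T-S5.12e `PlaquetteObsL4`** (S): `E₀[(c_p⁽²⁾)⁴] ≤ C/β⁴` (8-leg Wick, or w5's hypercontractivity) — the L⁴ bound that is LOAD-BEARING in the even part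
  of `f′(0)` (ASSEMBLY-S5 (e4): the sup bound would lose `β^{2κ₃}` and fail at θ = 1/13);
* **T-S5.13t `TiltSecondOrder`** (M, abstract, measure-theoretic): for a finite measure `μ ≠ 0` and bounded measurable `U, G₁, G₂`, the tilted covariance
  `f(t) = Cov_t(G₁,G₂)` satisfies `|f(1) − f(0) − κ₃,₀(G₁,G₂,U)| ≤ K/2` whenever the fourth joint cumulant `|κ₄,t(G₁,G₂,U,U)| ≤ K` on `[0,1]`
  (`f′ = κ₃,t`, `f″ = κ₄,t` along the tilt; Taylor with integral remainder) — applied with `μ = 1_D · (Hodge Gaussian)`, `U = tiltU β H`.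

HONEST LABEL: definitions and task statements only; S5 (`stub_landauSecondOrder`), ⟨stmt-QuantumFields-24004⟩ ⟨24335⟩ ⟨24336⟩ remain OPEN; route
AllWindowsColdBox is DRAFT; no rung is proved; the Yang–Mills mass gap is NOT proved by this file.
-/

set_option autoImplicit false

noncomputable section

open MeasureTheory Matrix Finset Real
open Literature.Probability.LatticeModels (Site)
open Literature.MathematicalPhysics.QuantumFieldTheory.Balaban1983to89.B10Eq22Rescaling (sigmaSU2)
open Literature.MathematicalPhysics.QuantumLattice (LGConfig fundamentalRep)
open Summit.QuantumFields.YangMills.Theorems.WeakCouplingRates (plaq12At)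

namespace Summit.QuantumFields.YangMills.Theorems.AllWindowsColdBoxBoxHighLine

/-! ## The tilt exponent on the small-field set -/

/-- The ghost log-ratio `log|det F_FP(U(a))| − log|det F_FP(1)|` (`= quadVal M_H a + E₃(a)` by T-S5.7d `GhostTaylor`). -/
def ghostLogRatio (H : ℕ) (a : LandauFree H → E3) : ℝ :=
  Real.log |(fpOperator H (edgeChart H a)).det| - Real.log |(fpOperator H 1).det|

/-- The Haar log-ratio `Σ_e log(σ(‖a_e‖)/σ(0))` (`= −Σ_e ‖a_e‖²/3 + O(Σ‖a_e‖⁴)` by T-S5.7c `HaarTaylor`). -/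
def haarLogRatio (H : ℕ) (a : LandauFree H → E3) : ℝ :=
  ∑ e : LandauFree H, Real.log (sigmaSU2 ‖a e‖ / sigmaSU2 0)

/-- **The tilt exponent** `U(a)`: on the small-field set, `w_J = |det F₁|·σ(0)^n·e^{−β·boxQuadForm}·e^{U}` (T-S5.5n). Parity: the first summand is odd in `a`,
the next two and the Haar term are even, the ghost term is even up to its cubic Taylor tail. -/
def tiltU (β : ℝ) (H : ℕ) (a : LandauFree H → E3) : ℝ :=
  -cubicVertex β H a - quarticWilson β H a - β * (landauPhi H (edgeChart H a) - divLinSq H a) + ghostLogRatio H a + haarLogRatio H a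

namespace Tilt

variable {Ω : Type*} [MeasurableSpace Ω]

/-- Tilted expectation `E_t[G] = ∫ G e^{tU} dμ / ∫ e^{tU} dμ`. -/
def tiltExp (μ : Measure Ω) (U : Ω → ℝ) (t : ℝ) (G : Ω → ℝ) : ℝ :=
  (∫ x, G x * Real.exp (t * U x) ∂μ) / ∫ x, Real.exp (t * U x) ∂μ

/-- Tilted covariance `Cov_t(G₁,G₂)`. -/
def tiltCov (μ : Measure Ω) (U : Ω → ℝ) (t : ℝ) (G₁ G₂ : Ω → ℝ) : ℝ :=
  tiltExp μ U t (fun x => G₁ x * G₂ x) - tiltExp μ U t G₁ * tiltExp μ U t G₂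

/-- Third joint cumulant `κ₃,t(G₁,G₂,U) = E_t[G̃₁ G̃₂ Ũ]` (centred at `t`) — the `t`-derivative of `Cov_t(G₁,G₂)`. -/
def tiltCum3 (μ : Measure Ω) (U : Ω → ℝ) (t : ℝ) (G₁ G₂ : Ω → ℝ) : ℝ :=
  tiltExp μ U t (fun x => (G₁ x - tiltExp μ U t G₁) * (G₂ x - tiltExp μ U t G₂) * (U x - tiltExp μ U t U))

/-- Fourth joint cumulant `κ₄,t(G₁,G₂,U,U) = E_t[G̃₁G̃₂ŨŨ] − E_t[G̃₁G̃₂]·E_t[ŨŨ] − 2·E_t[G̃₁Ũ]·E_t[G̃₂Ũ]` — the second `t`-derivative of `Cov_t(G₁,G₂)`. -/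
def tiltCum4 (μ : Measure Ω) (U : Ω → ℝ) (t : ℝ) (G₁ G₂ : Ω → ℝ) : ℝ :=
  tiltExp μ U t (fun x => (G₁ x - tiltExp μ U t G₁) * (G₂ x - tiltExp μ U t G₂) * (U x - tiltExp μ U t U) ^ 2) -
    tiltExp μ U t (fun x => (G₁ x - tiltExp μ U t G₁) * (G₂ x - tiltExp μ U t G₂)) * tiltExp μ U t (fun x => (U x - tiltExp μ U t U) ^ 2) -
    2 * (tiltExp μ U t (fun x => (G₁ x - tiltExp μ U t G₁) * (U x - tiltExp μ U t U)) *
      tiltExp μ U t (fun x => (G₂ x - tiltExp μ U t G₂) * (U x - tiltExp μ U t U)))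

end Tilt

/-! ## Task statements -/

/-- **T-S5.5n `FPChartWeightOnSmallField`** — exact factorisation of the FP-chart weight on the small-field set. -/
def FPChartWeightOnSmallField : Prop :=
  ∀ H : ℕ, 1 ≤ H → ∀ β r s : ℝ, 0 ≤ s → s ≤ r → s < Real.pi → ∀ a ∈ smallField H s, (fpOperator H (edgeChart H a)).det ≠ 0 →
    fpChartWeight β H r a =
      |(fpOperator H 1).det| * sigmaSU2 0 ^ Fintype.card (LandauFree H) * gaussWeight β H a * Real.exp (tiltU β H a)

/-- **T-S5.6s `SmallFieldSmallPlaquettes`** — small fields have small plaquettes: `17 s² ≤ spl²`, `s ≤ 1/100` ⇒ `smallField s ⊆ {SmallPlaquettes spl ∘ edgeChart}`. -/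
def SmallFieldSmallPlaquettes : Prop :=
  ∀ H : ℕ, ∀ s spl : ℝ, 0 ≤ s → s ≤ 1 / 100 → 17 * s ^ 2 ≤ spl ^ 2 → ∀ a ∈ smallField H s, SmallPlaquettes H spl (edgeChart H a)

/-- **T-S5.12e `PlaquetteObsL4`** — fourth Gaussian moment of the linearised plaquette observable: `E₀[(c_p⁽²⁾)⁴] ≤ C/β⁴`. -/
def PlaquetteObsL4 : Prop :=
  ∃ C : ℝ, ∀ H : ℕ, 1 ≤ H → ∀ β : ℝ, 1 ≤ β → ∀ x : Site 4, gaussAvg β H (fun a => linCurvSq H (plaq12At x) a ^ 4) ≤ C / β ^ 4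

/-- **T-S5.13t `TiltSecondOrder`** — second-order Taylor bound for a tilted covariance in terms of the fourth joint cumulant along the tilt. -/
def TiltSecondOrder : Prop :=
  ∀ (Ω : Type) [MeasurableSpace Ω] (μ : Measure Ω) [IsFiniteMeasure μ], μ ≠ 0 →
    ∀ U G₁ G₂ : Ω → ℝ, Measurable U → Measurable G₁ → Measurable G₂ → (∃ B : ℝ, ∀ x, |U x| ≤ B ∧ |G₁ x| ≤ B ∧ |G₂ x| ≤ B) →
    ∀ K : ℝ, (∀ t ∈ Set.Icc (0 : ℝ) 1, |Tilt.tiltCum4 μ U t G₁ G₂| ≤ K) →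
      |Tilt.tiltCov μ U 1 G₁ G₂ - Tilt.tiltCov μ U 0 G₁ G₂ - Tilt.tiltCum3 μ U 0 G₁ G₂| ≤ K / 2

/-! Sanity. -/
example : FPChartWeightOnSmallField → SmallFieldSmallPlaquettes → PlaquetteObsL4 → TiltSecondOrder → True := fun _ _ _ _ => trivial

example {Ω : Type} [MeasurableSpace Ω] (μ : Measure Ω) (U G : Ω → ℝ) :
    Tilt.tiltExp μ U 0 G = (∫ x, G x ∂μ) / ∫ _x, (1 : ℝ) ∂μ := by
  simp [Tilt.tiltExp]

end Summit.QuantumFields.YangMills.Theorems.AllWindowsColdBoxBoxHighLine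

end
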